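import Summits.QuantumFields.YangMills.Theorems.AlphaInputsT3ACv3DataSchemaChi
import Literature.MathematicalPhysics.QuantumFieldTheory.Balaban1983to89.B10Eq27TorusAxialLog
import Literature.MathematicalPhysics.QuantumFieldTheory.Balaban1983to89.B3Taylor310LocalRemainder
import HarnessLib

/-!
# `AlphaInputsT3ACv3OldTermRowsOfShape43` — THE DOOR «(α) rows `h44` ∧ `hfloor` ⟸ (43) on the old coefficients + two D-class identification letters + the
# level-`j` averaged plaquette letter», ON THE TORUS CARRIER OF RECORD (cell `ym3-torus`, ★★OWNER g35 word 2026-08-30 11:28Z «GO DOOR (G2)» on the LOCATE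
# `LOCATE-h44-hfloor-cstp1g37.md` = 19936 evidence #44; seat `ym-line-cst-p1` g37, free hand; `--supports stmt-QuantumFields-19936 --as helper`)

THE TWO ROWS (NODE-O bill #18–19, ids D-44∕D-44′; fields `.h44`∕`.hfloor` of `AlphaV3AC.StepDataV3CoreAC` = `…v3DataSchemaChi.lean` :137∕:141 = `…v3Lane.lean` :131∕:135,
hence of the `k`-th `StepDataV3ChiAC` conjunct of the (O‴χₛ) stub `DataRowsT3XsChiSel` of `HistoryTailL` (19936), registry v6 `stub_selXsV4DataRows`):

    h44    : ∀ h U, ∀ j ∈ Icc 1 k, Bound44 (oldGeom S.P k j) (fun y n c => (𝔖 k).oldVal h U j y n c) 𝔠.κ₁ 𝔠.M₁ (ell S.P k j) L 𝔠.B₃ (S.gk k) (pFun 𝔠.b₀ 𝔠.p₀ (S.gk k)) 𝔠.C44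
    hfloor : ∀ h U, ∀ j ∈ Icc 1 k, ∀ y n c, (𝔖 k).oldVal h U j y n c ≠ 0 → 2 ≤ n

i.e. [Balaban1985UV3] (44) p.267 («|𝒫_j(Y_j, U_k)| ≤ O(1)∏ᵢ exp(−κ₁(M₁L^jη)⁻¹|c_{i,−} − y|)·(L^jη)⁻¹|c_{i,−} − y|·8L²B₃g_{k−1}p(g_{k−1})(L^jη)²») and the degree floor «n ≥ 2»
of (43) p.266, for the ∃-bound previous-scale terms `oldVal` of the expansion data, at EVERY history `h` and EVERY coarse field `U`.

WHAT THIS FILE PROVES (theorems only; 0 `def`, 0 `sorry`; nothing conclusion-shaped among the hypotheses).  Print derives (44) from three things: the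
INDUCTIVE form (43) of the old terms (`𝒫_j(Y_j, U_k) = ⟨𝒫_j(Y_j), B_k(c₁), …, B_k(c_n)⟩`, `n ≥ 2`, `|c_{i,−} − y| < R(g_j)M₁L^jη`, `|𝒫_j(Y_j)| ≤ O(1)∏e^{−κ₁…}`),
the loop-variable bound (28) `|B_k(c)| ≤ 2|c₋ − y|₁·α` from the plaquette bounds `α` near `y` (axial ladder), and the regularity «`|Ū_k^j(∂p′) − 1| < 4L²B₃g p(g)(L^jη)²`»
(the sentence before (44)).  Accordingly:
* §1 ★★ `bound44_of_shape43_torus` ∕ `floor_of_coef` — ON ONE TORUS LEVEL `T^{(j)}` (`Site P j`, `PBond P j`) for ANY unit-valued field `V : GaugeField P j 𝔸ˣ`, ANY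
  coefficient sizes `coef` and term sizes `PU` on LQB's geometry `oldGeom P k j` (`dist = ℓ·tdist`, `ℓ = ell P k j = L^{−(k−j)}`): IF `Shape43 (oldGeom P k j) coef κ₁ M₁ ℓ C`
  ((43): DISPLAYED), IF `coef y n c ≠ 0 → tdist (c i).src y ≤ R` ((43)'s index set), IF `|PU y n c| ≤ |coef y n c|·∏ᵢ‖B27T V y (c i)‖` (the multilinear reading of
  `⟨𝒫_j(Y_j), B(c₁),…,B(c_n)⟩`: DISPLAYED, D-class), IF the plaquettes `⟨y + z; κ, μ⟩`, `z ∈ [−(R+1), R+1]^d`, of `V` are within `4L²B₃(g·pg)ℓ²` of `1` wherever `coef y ≠ 0`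
  (DISPLAYED), and `R·4L²B₃(g·pg)ℓ² ≤ ½`: THEN `Bound44 (oldGeom P k j) PU κ₁ M₁ ℓ L B₃ g pg C` — by ✓`B10SectCExpansion.bound44_of_shape43` fed with the loop letter
  `loop y b := min ‖B27T V y b‖ ((ℓ⁻¹·dist)·(8L²B₃ g pg ℓ²))` and ✓`B10Eq27TorusAxialLog.norm_B27T_le` ((28) on the torus: `‖B27T V y c‖ ≤ 2·|c₋ − y|₁·α`), the dictionary
  `|c₋ − y|₁ = tdist` (`l1_rel_eq_tdist`) making `2·tdist·α = (ℓ⁻¹·(ℓ·tdist))·(8L²B₃ g pg ℓ²)` — print's loop factor LETTER FOR LETTER; and `PU ≠ 0 → coef ≠ 0 → 2 ≤ n`.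
* §2 ★★★ `h44_of_letters` ∕ `hfloor_of_letters` ∕ `oldTermRows_of_letters` — THE SOCKET EDITION: in the variable context of `StepDataV3CoreAC 𝔊 𝔠 X 𝔖 𝔄 win k` (any gauge
  group model, any `AlphaConsts`, any expansion data `𝔖`), from the same four letters quantified over `(h, U, j)` — coefficient family `coef h U j`, old fields
  `Vold h U j : GaugeField S.P j 𝔸ˣ`, radius `R j` — the CONCLUSIONS ARE THE TWO FIELD TYPES VERBATIM (dock by field projection ∕ `exact`).
PROVENANCE OF THE LETTERS on Bałaban's object (B0, not constructed): `coef h U j y n c = |𝒫_j((y,c))|` (the multilinear norm of the old coefficient — (43) is then print's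
inductive hypothesis (13) carried to step `k`, the ONE estimate row); `Vold h U j = unitsField (toUField (Averaging.iter (blockAvg ℰp) j (UkH (k+1) h U)))` and
`oldVal h U j y n c = ⟨𝒫_j, B27T Vold y (c ·)⟩` on the χₛ class, `:= 0` off it (G-B10-05's «arbitrary configuration having the same properties as U_k» = `adaptedClassT3Xs`
in the χₛ currency) — so the identification letters are B0 OUTPUT (D-class, like `hPY`∕`hPYZ`); the plaquette letter is the χₛ class's `reg68LevelsSet` clause
(`…v3AdaptedClass.lean` :151, threshold `C68·θBal(K−i)·L^{−2(i−s)}`) read at `(i, s) = (k+1, j)` on the `R j`-box — BY NAME once `C68 ≤ 4L²B₃` is pinned (the record has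
`4B₃L²·avgWindowFactor ≤ C68`, the other direction: a constants knit for the definer, recorded in the LOCATE §4); `R j = Rcol j` (`oldBonds`), smallness = print's «g_{k−1} sufficiently small».
NON-VACUITY.  The zero `StepSeries` (all `oldVal = 0`) meets every hypothesis with `coef := 0` AND meets the rows — as it meets the rows themselves (bill §0 L1); the door's content
is at `coef ≠ 0`: e.g. one coefficient `coef y 2 c = 1` with `PU := ∏‖B27T V y (c i)‖` is NOT covered by anything but §1, which computes (44)'s right-hand side from the plaquettes.
HONEST SCOPE: a door; (α) data rows 0∕23 unchanged; `h44`∕`hfloor` as data rows on `𝔖_Bal` remain XL∕B0; (43) itself is a hypothesis; nothing of (O‴χₛ), `HistoryTailL` (19936),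
EX, `YM3TorusSU2` (R3 — SU(2) YM₃ on T³, a RECORD rung: NOT d = 4, NOT infinite volume, NOT a mass gap, NOT Clay) is proved; the Yang–Mills mass gap is NOT proved.

References: T. Bałaban, Commun. Math. Phys. **102** (1985) 255–275 [Balaban1985UV3] ((43) p.266, (44) p.267, (27)–(28) p.263); Commun. Math. Phys. **98** (1985) 17–51
[Balaban1985Averaging] (pp.24–25, the axial ladder); Commun. Math. Phys. **102** (1985) 277–309 [Balaban1985Variational] (Prop 4 (97)–(98) pp.292–293).
-/

set_option autoImplicit false

noncomputable section

namespace Summit.QuantumFields.YangMills.Theorems.AlphaV3OldTermRowsOfShape43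

open scoped BigOperators
open Literature.MathematicalPhysics.QuantumFieldTheory.Balaban1983to89
open Literature.MathematicalPhysics.QuantumFieldTheory.Balaban1983to89.B10SectCExpansion (VertexGeometry TermSizes Shape43 Bound44 bound44_of_shape43)
open Literature.MathematicalPhysics.QuantumFieldTheory.Balaban1983to89.B10Eq27TorusAxialLog (transl rel holT B27T norm_B27T_le transl_rel rel_apply)
open B7Prop1Explicit renaming Site → LSite
open B7Prop1Explicit (e l1 U1 plaqWord e_apply)
open B7Prop1Local (InBox PlaqIn)
open Summit.QuantumFields.Balaban3D.Carriers (oldGeom ell ell_pos)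

/-! ## §0 The torus dictionary `|c₋ − y|₁ = tdist` and the box about `y` -/

section Dictionary

variable {P : Params} {j : ℕ}

/-- `|x − y|₁ = tdist(y, x)` at every level: the `ℓ¹` length of the least-absolute-value relative position is the torus distance
(✓`B3Taylor310LocalRemainder.tdist_eq_sum_natAbs`). [folklore] -/
theorem l1_rel_eq_tdist (y x : Site P j) : l1 (rel y x) = Site.tdist x y := by
  rw [B3Taylor310LocalRemainder.tdist_eq_sum_natAbs]
  rfl

/-- Each coordinate of `x − y` is at most `|x − y|₁` in absolute value. [folklore] -/
theorem natAbs_rel_le_l1 (y x : Site P j) (ν : Fin P.d) : (rel y x ν).natAbs ≤ l1 (rel y x) := by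
  unfold l1
  exact Finset.single_le_sum (f := fun κ => (rel y x κ).natAbs) (fun _ _ => Nat.zero_le _) (Finset.mem_univ ν)

/-- The symmetric integer box `[−(R+1), R+1]^d` contains `0`. [folklore] -/
theorem inBox_zero (R : ℕ) : InBox (fun _ : Fin P.d => -((R : ℤ) + 1)) (fun _ => (R : ℤ) + 1) 0 := fun i => by
  have hR : (0 : ℤ) ≤ R := Nat.cast_nonneg R
  simp only [Pi.zero_apply]
  constructor <;> linarith

/-- If `tdist(c₋, y) ≤ R` then `c₋ − y ∈ [−(R+1), R+1]^d`. [folklore] -/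
theorem inBox_rel_of_tdist_le {R : ℕ} (y x : Site P j) (h : Site.tdist x y ≤ R) :
    InBox (fun _ : Fin P.d => -((R : ℤ) + 1)) (fun _ => (R : ℤ) + 1) (rel y x) := fun i => by
  have h1 : (rel y x i).natAbs ≤ R := (natAbs_rel_le_l1 y x i).trans (by rw [l1_rel_eq_tdist]; exact h)
  have h2 : ((rel y x i).natAbs : ℤ) ≤ R := by exact_mod_cast h1
  rw [Int.natCast_natAbs] at h2
  have h3 : rel y x i ≤ |rel y x i| := le_abs_self _
  have h4 : -|rel y x i| ≤ rel y x i := neg_abs_le _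
  show -((R : ℤ) + 1) ≤ rel y x i ∧ rel y x i ≤ (R : ℤ) + 1
  constructor <;> omega

/-- If `tdist(c₋, y) ≤ R` then `c₋ − y + e_μ ∈ [−(R+1), R+1]^d`. [folklore] -/
theorem inBox_rel_add_e_of_tdist_le {R : ℕ} (y x : Site P j) (μ : Fin P.d) (h : Site.tdist x y ≤ R) :
    InBox (fun _ : Fin P.d => -((R : ℤ) + 1)) (fun _ => (R : ℤ) + 1) (rel y x + e μ) := fun i => by
  have h1 : (rel y x i).natAbs ≤ R := (natAbs_rel_le_l1 y x i).trans (by rw [l1_rel_eq_tdist]; exact h)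
  have h2 : ((rel y x i).natAbs : ℤ) ≤ R := by exact_mod_cast h1
  rw [Int.natCast_natAbs] at h2
  have h3 : rel y x i ≤ |rel y x i| := le_abs_self _
  have h4 : -|rel y x i| ≤ rel y x i := neg_abs_le _
  show -((R : ℤ) + 1) ≤ (rel y x + e μ) i ∧ (rel y x + e μ) i ≤ (R : ℤ) + 1
  rw [Pi.add_apply, e_apply]
  split_ifs <;> constructor <;> omega

end Dictionary

/-! ## §1 (43) + the plaquette letter ⇒ (44), on one torus level -/

section OneLevel

variable {P : Params} {k j : ℕ} {𝔸 : Type*} [NormedRing 𝔸] [NormOneClass 𝔸] [NormedAlgebra ℂ 𝔸] [CompleteSpace 𝔸]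

/-- ★★ **(43) + (28) + THE AVERAGED REGULARITY ⇒ (44), ON THE TORUS LEVEL `T^{(j)}`.**  For a unit-valued field `V` on the bonds of `T^{(j)}` (the old field `Ū^j` read in `𝔸ˣ`),
coefficient sizes `coef` with (43) (`Shape43`: degree floor `n ≥ 2` and decay `|coef y n c| ≤ C∏ᵢe^{−κ₁(M₁ℓ)⁻¹·dist(c_{i,−}, y)}`) supported on the bonds within torus distance `R` of
the block `y`, term sizes `PU` read multilinearly through the loop variables (27) (`|PU y n c| ≤ |coef y n c|·∏ᵢ‖B27T V y (c i)‖`), and plaquettes within `4L²B₃(g·pg)ℓ²` of `1` on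
the `(R+1)`-box about every `y` carrying a coefficient, with `R·4L²B₃(g·pg)ℓ² ≤ ½`: print's (44) `|PU y n c| ≤ C∏ᵢ e^{−κ₁(M₁ℓ)⁻¹dist}·((ℓ⁻¹dist)·(8L²B₃ g pg ℓ²))`.
(`ℓ = ell P k j`, `dist = ℓ·tdist` = `oldGeom`.)  [cite: Balaban1985UV3, (43)–(44) pp.266–267; Balaban1985Averaging, pp.24–25] -/
theorem bound44_of_shape43_torus (V : GaugeField P j 𝔸ˣ) (hV : ∀ b, V b ∈ U1 𝔸) (coef PU : TermSizes (oldGeom P k j))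
    {κ₁ M₁ L B₃ g pg C : ℝ} (R : ℕ) (hC : 0 ≤ C) (hα : 0 ≤ 4 * L ^ 2 * B₃ * (g * pg) * ell P k j ^ 2)
    (h43 : Shape43 (oldGeom P k j) coef κ₁ M₁ (ell P k j) C)
    (hsupp : ∀ (y : Site P j) (n : ℕ) (c : Fin n → PBond P j), coef y n c ≠ 0 → ∀ i, Site.tdist (c i).src y ≤ R)
    (hid : ∀ (y : Site P j) (n : ℕ) (c : Fin n → PBond P j), |PU y n c| ≤ |coef y n c| * ∏ i, ‖B27T V y (c i)‖)
    (hplaq : ∀ (y : Site P j), (∃ (n : ℕ) (c : Fin n → PBond P j), coef y n c ≠ 0) →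
      ∀ (z : LSite P.d) (κ μ : Fin P.d), κ ≠ μ → PlaqIn (fun _ : Fin P.d => -((R : ℤ) + 1)) (fun _ => (R : ℤ) + 1) (z, κ, μ) →
        ‖((holT V (transl y z) (plaqWord κ μ) : 𝔸ˣ) : 𝔸) - 1‖ ≤ 4 * L ^ 2 * B₃ * (g * pg) * ell P k j ^ 2)
    (hsmall : (R : ℝ) * (4 * L ^ 2 * B₃ * (g * pg) * ell P k j ^ 2) ≤ 1 / 2) :
    Bound44 (oldGeom P k j) PU κ₁ M₁ (ell P k j) L B₃ g pg C := by
  classical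
  set ℓ : ℝ := ell P k j with hℓ
  have hℓ0 : 0 < ℓ := ell_pos P k j
  set α : ℝ := 4 * L ^ 2 * B₃ * (g * pg) * ℓ ^ 2 with hαdef
  -- the printed loop factor of (44) at the bond `b` seen from the block `y`
  set fac : Site P j → PBond P j → ℝ := fun y b =>
    (ℓ⁻¹ * (oldGeom P k j).dist ((oldGeom P k j).cminus b) y) * (8 * L ^ 2 * B₃ * g * pg * ℓ ^ 2) with hfac
  have hfac_eq : ∀ (y : Site P j) (b : PBond P j), fac y b = 2 * ((Site.tdist b.src y : ℝ) * α) := by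
    intro y b
    have h1 : ℓ⁻¹ * ℓ = 1 := inv_mul_cancel₀ hℓ0.ne'
    simp only [hfac]
    rw [← hℓ, hαdef]
    calc ℓ⁻¹ * (ℓ * (Site.tdist b.src y : ℝ)) * (8 * L ^ 2 * B₃ * g * pg * ℓ ^ 2)
        = (ℓ⁻¹ * ℓ) * (Site.tdist b.src y : ℝ) * (8 * L ^ 2 * B₃ * g * pg * ℓ ^ 2) := by ring
      _ = 2 * ((Site.tdist b.src y : ℝ) * (4 * L ^ 2 * B₃ * (g * pg) * ℓ ^ 2)) := by rw [h1]; ring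
  have hfac_nonneg : ∀ y b, 0 ≤ fac y b := fun y b => by rw [hfac_eq]; positivity
  -- the loop letter: the loop variable capped by the printed factor
  set loop : Site P j → PBond P j → ℝ := fun y b => min ‖B27T V y b‖ (fac y b) with hloop
  refine bound44_of_shape43 (oldGeom P k j) coef PU loop hC h43 (fun y b => le_min (norm_nonneg _) (hfac_nonneg y b))
    (fun y b => min_le_right _ _) ?_
  -- the multilinear reading: at a live coefficient every bond is near `y`, so the cap is inactive by (28)
  intro y n c
  by_cases hc0 : coef y n c = 0
  · have := hid y n c
    rw [hc0, abs_zero, zero_mul] at this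
    rw [hc0, abs_zero, zero_mul]
    exact this
  · have hnear := hsupp y n c hc0
    have h13 := hplaq y ⟨n, c, hc0⟩
    have hB : ∀ i, ‖B27T V y (c i)‖ ≤ fac y (c i) := by
      intro i
      have hti := hnear i
      have hl1 : (l1 (rel y (c i).src) : ℝ) = Site.tdist (c i).src y := by exact_mod_cast l1_rel_eq_tdist y (c i).src
      have hsm : (l1 (rel y (c i).src) : ℝ) * α ≤ 1 / 2 := by
        rw [hl1]
        have : (Site.tdist (c i).src y : ℝ) ≤ R := by exact_mod_cast hti
        exact (mul_le_mul_of_nonneg_right this hα).trans hsmall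
      have h := norm_B27T_le (lo := fun _ : Fin P.d => -((R : ℤ) + 1)) (hi := fun _ => (R : ℤ) + 1)
        (fun _ => by linarith [(Nat.cast_nonneg R : (0 : ℤ) ≤ R)]) V hV y h13 hα (inBox_zero R) (c i)
        (inBox_rel_of_tdist_le y (c i).src hti) (inBox_rel_add_e_of_tdist_le y (c i).src (c i).dir hti) hsm
      rw [hfac_eq, ← hl1]
      exact h
    have hprod : ∏ i, ‖B27T V y (c i)‖ = ∏ i, loop y (c i) :=
      Finset.prod_congr rfl fun i _ => (min_eq_left (hB i)).symm
    rw [← hprod]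
    exact hid y n c

omit [NormOneClass 𝔸] [NormedAlgebra ℂ 𝔸] [CompleteSpace 𝔸] in
/-- **THE DEGREE FLOOR OF THE TERMS FROM THAT OF THE COEFFICIENTS**: if `PU ≠ 0 → coef ≠ 0` and `coef` has the floor «n ≥ 2» of (43), so does `PU`. [cite: Balaban1985UV3, (43) p.266] -/
theorem floor_of_coef {X : VertexGeometry} (coef PU : TermSizes X) {κ₁ M₁ ℓ C : ℝ} (h43 : Shape43 X coef κ₁ M₁ ℓ C)
    (hid0 : ∀ (y : X.Site) (n : ℕ) (c : Fin n → X.Bond), PU y n c ≠ 0 → coef y n c ≠ 0) :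
    ∀ (y : X.Site) (n : ℕ) (c : Fin n → X.Bond), PU y n c ≠ 0 → 2 ≤ n :=
  fun y n c h => h43.1 y n c (hid0 y n c h)

end OneLevel

/-! ## §2 The socket edition: the two row FIELD TYPES of `StepDataV3CoreAC`, from the letters -/

section Socket

open Literature.MathematicalPhysics.QuantumFieldTheory.Balaban1983to89.B10 (pFun pFun_nonneg)
open Literature.MathematicalPhysics.QuantumFieldTheory.Balaban1985CMP102
open Literature.MathematicalPhysics.QuantumFieldTheory.Balaban1985CMP102.Setting
open Summit.QuantumFields.Balaban3D.Carriers
open Summit.QuantumFields.Balaban3D.Proofs.Primitives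
open Summit.QuantumFields.Balaban3D.Proofs.GroupModelLieC (lieC)
open Summit.QuantumFields.Balaban3D.Proofs.ScalesArithmetic (gk_pos gk_le_one)

variable {L : ℕ} {S : Scales L} {G : Type} [GaugeGroup G] [MeasurableSpace G] [HaarData G] (𝔊 : GroupModel G) (𝔠 : AlphaConsts L 𝔊.N)
  (𝔖 : ∀ k, StepSeries S G ↥(lieC 𝔊) (nblkOf S 𝔠.lane.carrier k) k) (k : ℕ)
  {𝔸 : Type*} [NormedRing 𝔸] [NormOneClass 𝔸] [NormedAlgebra ℂ 𝔸] [CompleteSpace 𝔸]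
  (coef : Hist S.P (k + 1) → GaugeField S.P (k + 1) G → (j : ℕ) → TermSizes (oldGeom S.P k j))
  (Vold : Hist S.P (k + 1) → GaugeField S.P (k + 1) G → (j : ℕ) → GaugeField S.P j 𝔸ˣ) (R : ℕ → ℕ)

/-- ★★★ **ROW `h44` OF `StepDataV3CoreAC` FROM THE LETTERS** — conclusion = the field type of `.h44` VERBATIM (`…v3DataSchemaChi.lean` :137 = `…v3Lane.lean` :131).  Letters, each
quantified over the history `h`, the coarse field `U` and the old scale `j ∈ Icc 1 k`: (43) `Shape43` on the coefficient family `coef h U j` with (43)'s index radius `R j` (the ONE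
estimate row — print's inductive (13)); the identification `|(𝔖 k).oldVal h U j y n c| ≤ |coef h U j y n c|·∏ᵢ‖B27T (Vold h U j) y (c i)‖` (D-class, B0 output); `Vold h U j`
unit-valued; the level-`j` plaquette letter `‖Vold(∂⟨y+z;κ,μ⟩) − 1‖ ≤ 4L²B₃·g_k p(g_k)·ℓ²` on the `(R j + 1)`-box about each live block (χₛ: the `reg68LevelsSet` clause); the
smallness `R j·4L²B₃ g_k p(g_k) ℓ² ≤ ½`. [cite: Balaban1985UV3, (44) p.267] -/
theorem h44_of_letters (hk : k + 1 ≤ S.K)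
    (h43 : ∀ (h : Hist S.P (k + 1)) (U : GaugeField S.P (k + 1) G), ∀ j ∈ Finset.Icc 1 k,
      Shape43 (oldGeom S.P k j) (coef h U j) 𝔠.κ₁ (𝔠.M₁ : ℝ) (ell S.P k j) 𝔠.C44)
    (hsupp : ∀ (h : Hist S.P (k + 1)) (U : GaugeField S.P (k + 1) G), ∀ j ∈ Finset.Icc 1 k,
      ∀ (y : Site S.P j) (n : ℕ) (c : Fin n → PBond S.P j), coef h U j y n c ≠ 0 → ∀ i, Site.tdist (c i).src y ≤ R j)
    (hid : ∀ (h : Hist S.P (k + 1)) (U : GaugeField S.P (k + 1) G), ∀ j ∈ Finset.Icc 1 k,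
      ∀ (y : Site S.P j) (n : ℕ) (c : Fin n → PBond S.P j), |(𝔖 k).oldVal h U j y n c| ≤ |coef h U j y n c| * ∏ i, ‖B27T (Vold h U j) y (c i)‖)
    (hV : ∀ (h : Hist S.P (k + 1)) (U : GaugeField S.P (k + 1) G) (j : ℕ) (b : PBond S.P j), Vold h U j b ∈ U1 𝔸)
    (hplaq : ∀ (h : Hist S.P (k + 1)) (U : GaugeField S.P (k + 1) G), ∀ j ∈ Finset.Icc 1 k, ∀ (y : Site S.P j),
      (∃ (n : ℕ) (c : Fin n → PBond S.P j), coef h U j y n c ≠ 0) →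
      ∀ (z : LSite S.P.d) (κ μ : Fin S.P.d), κ ≠ μ → PlaqIn (fun _ : Fin S.P.d => -((R j : ℤ) + 1)) (fun _ => (R j : ℤ) + 1) (z, κ, μ) →
        ‖((holT (Vold h U j) (transl y z) (plaqWord κ μ) : 𝔸ˣ) : 𝔸) - 1‖ ≤
          4 * (L : ℝ) ^ 2 * 𝔠.B₃ * (S.gk k * pFun 𝔠.b₀ 𝔠.p₀ (S.gk k)) * ell S.P k j ^ 2)
    (hsmall : ∀ j ∈ Finset.Icc 1 k, (R j : ℝ) * (4 * (L : ℝ) ^ 2 * 𝔠.B₃ * (S.gk k * pFun 𝔠.b₀ 𝔠.p₀ (S.gk k)) * ell S.P k j ^ 2) ≤ 1 / 2) :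
    ∀ (h : Hist S.P (k + 1)) (U : GaugeField S.P (k + 1) G), ∀ j ∈ Finset.Icc 1 k,
      Bound44 (oldGeom S.P k j) (fun y n c => (𝔖 k).oldVal h U j y n c) 𝔠.κ₁ (𝔠.M₁ : ℝ) (ell S.P k j) (L : ℝ) 𝔠.B₃
        (S.gk k) (pFun 𝔠.b₀ 𝔠.p₀ (S.gk k)) 𝔠.C44 := by
  intro h U j hj
  have hg0 : 0 < S.gk k := gk_pos S k
  have hg1 : S.gk k ≤ 1 := gk_le_one S S.gK_le_one k (by omega)
  have hgp : 0 ≤ S.gk k * pFun 𝔠.b₀ 𝔠.p₀ (S.gk k) := mul_nonneg hg0.le (pFun_nonneg 𝔠.b₀ 𝔠.p₀ (S.gk k) 𝔠.b₀_pos.le hg0 hg1)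
  have hB : 0 ≤ 𝔠.B₃ := 𝔠.B₃_pos.le
  have hα : 0 ≤ 4 * (L : ℝ) ^ 2 * 𝔠.B₃ * (S.gk k * pFun 𝔠.b₀ 𝔠.p₀ (S.gk k)) * ell S.P k j ^ 2 := by positivity
  exact bound44_of_shape43_torus (Vold h U j) (hV h U j) (coef h U j) (fun y n c => (𝔖 k).oldVal h U j y n c) (R j)
    𝔠.C44_nonneg hα (h43 h U j hj) (hsupp h U j hj) (hid h U j hj) (hplaq h U j hj) (hsmall j hj)

omit [NormOneClass 𝔸] [NormedAlgebra ℂ 𝔸] [CompleteSpace 𝔸] in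
/-- ★★ **ROW `hfloor` OF `StepDataV3CoreAC` FROM THE LETTERS** — conclusion = the field type of `.hfloor` VERBATIM (`…v3DataSchemaChi.lean` :141 = `…v3Lane.lean` :135): the degree
floor «n ≥ 2» of the old terms from (43)'s floor on the coefficients and the identification letter `oldVal ≠ 0 → coef ≠ 0` (D-class, B0 output).
[cite: Balaban1985UV3, (43) p.266] -/
theorem hfloor_of_letters
    (h43 : ∀ (h : Hist S.P (k + 1)) (U : GaugeField S.P (k + 1) G), ∀ j ∈ Finset.Icc 1 k,
      Shape43 (oldGeom S.P k j) (coef h U j) 𝔠.κ₁ (𝔠.M₁ : ℝ) (ell S.P k j) 𝔠.C44)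
    (hid0 : ∀ (h : Hist S.P (k + 1)) (U : GaugeField S.P (k + 1) G), ∀ j ∈ Finset.Icc 1 k,
      ∀ (y : Site S.P j) (n : ℕ) (c : Fin n → PBond S.P j), (𝔖 k).oldVal h U j y n c ≠ 0 → coef h U j y n c ≠ 0) :
    ∀ (h : Hist S.P (k + 1)) (U : GaugeField S.P (k + 1) G), ∀ j ∈ Finset.Icc 1 k,
      ∀ (y : Site S.P j) (n : ℕ) (c : Fin n → PBond S.P j), (𝔖 k).oldVal h U j y n c ≠ 0 → 2 ≤ n :=
  fun h U j hj => floor_of_coef (coef h U j) (fun y n c => (𝔖 k).oldVal h U j y n c) (h43 h U j hj) (hid0 h U j hj)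

/-- ★★★ **BOTH ROWS AT ONCE** (`h44`-text ∧ `hfloor`-text), for the record: bill rows #18–19 are NOT independent estimate rows — they follow from ONE estimate row ((43) on the old
coefficients), two D-class identification letters and the level-`j` averaged plaquette letter the χₛ class already carries. [cite: Balaban1985UV3, (43)–(44) pp.266–267] -/
theorem oldTermRows_of_letters (hk : k + 1 ≤ S.K)
    (h43 : ∀ (h : Hist S.P (k + 1)) (U : GaugeField S.P (k + 1) G), ∀ j ∈ Finset.Icc 1 k,
      Shape43 (oldGeom S.P k j) (coef h U j) 𝔠.κ₁ (𝔠.M₁ : ℝ) (ell S.P k j) 𝔠.C44)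
    (hsupp : ∀ (h : Hist S.P (k + 1)) (U : GaugeField S.P (k + 1) G), ∀ j ∈ Finset.Icc 1 k,
      ∀ (y : Site S.P j) (n : ℕ) (c : Fin n → PBond S.P j), coef h U j y n c ≠ 0 → ∀ i, Site.tdist (c i).src y ≤ R j)
    (hid : ∀ (h : Hist S.P (k + 1)) (U : GaugeField S.P (k + 1) G), ∀ j ∈ Finset.Icc 1 k,
      ∀ (y : Site S.P j) (n : ℕ) (c : Fin n → PBond S.P j), |(𝔖 k).oldVal h U j y n c| ≤ |coef h U j y n c| * ∏ i, ‖B27T (Vold h U j) y (c i)‖)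
    (hid0 : ∀ (h : Hist S.P (k + 1)) (U : GaugeField S.P (k + 1) G), ∀ j ∈ Finset.Icc 1 k,
      ∀ (y : Site S.P j) (n : ℕ) (c : Fin n → PBond S.P j), (𝔖 k).oldVal h U j y n c ≠ 0 → coef h U j y n c ≠ 0)
    (hV : ∀ (h : Hist S.P (k + 1)) (U : GaugeField S.P (k + 1) G) (j : ℕ) (b : PBond S.P j), Vold h U j b ∈ U1 𝔸)
    (hplaq : ∀ (h : Hist S.P (k + 1)) (U : GaugeField S.P (k + 1) G), ∀ j ∈ Finset.Icc 1 k, ∀ (y : Site S.P j),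
      (∃ (n : ℕ) (c : Fin n → PBond S.P j), coef h U j y n c ≠ 0) →
      ∀ (z : LSite S.P.d) (κ μ : Fin S.P.d), κ ≠ μ → PlaqIn (fun _ : Fin S.P.d => -((R j : ℤ) + 1)) (fun _ => (R j : ℤ) + 1) (z, κ, μ) →
        ‖((holT (Vold h U j) (transl y z) (plaqWord κ μ) : 𝔸ˣ) : 𝔸) - 1‖ ≤
          4 * (L : ℝ) ^ 2 * 𝔠.B₃ * (S.gk k * pFun 𝔠.b₀ 𝔠.p₀ (S.gk k)) * ell S.P k j ^ 2)
    (hsmall : ∀ j ∈ Finset.Icc 1 k, (R j : ℝ) * (4 * (L : ℝ) ^ 2 * 𝔠.B₃ * (S.gk k * pFun 𝔠.b₀ 𝔠.p₀ (S.gk k)) * ell S.P k j ^ 2) ≤ 1 / 2) :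
    (∀ (h : Hist S.P (k + 1)) (U : GaugeField S.P (k + 1) G), ∀ j ∈ Finset.Icc 1 k,
      Bound44 (oldGeom S.P k j) (fun y n c => (𝔖 k).oldVal h U j y n c) 𝔠.κ₁ (𝔠.M₁ : ℝ) (ell S.P k j) (L : ℝ) 𝔠.B₃
        (S.gk k) (pFun 𝔠.b₀ 𝔠.p₀ (S.gk k)) 𝔠.C44) ∧
    (∀ (h : Hist S.P (k + 1)) (U : GaugeField S.P (k + 1) G), ∀ j ∈ Finset.Icc 1 k,
      ∀ (y : Site S.P j) (n : ℕ) (c : Fin n → PBond S.P j), (𝔖 k).oldVal h U j y n c ≠ 0 → 2 ≤ n) :=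
  ⟨h44_of_letters 𝔊 𝔠 𝔖 k coef Vold R hk h43 hsupp hid hV hplaq hsmall, hfloor_of_letters 𝔊 𝔠 𝔖 k coef h43 hid0⟩

end Socket

end Summit.QuantumFields.YangMills.Theorems.AlphaV3OldTermRowsOfShape43

end
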